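import Summits.RiemannHypothesis.RiemannHypothesis.Theses.NbTruncationBarrier
import Summits.RiemannHypothesis.RiemannHypothesis.Theorems.Splittings.NbTruncationD
import HarnessLib

/-!
# Route NbTruncationBarrier (L6 «NB TRUNCATION BARRIER B21 + T45») — crux `SectionZeroRightOfHalf` (RH-FREE)

Item stmt-RiemannHypothesis-21762 (`∀ M ≥ 3, ∃ ρ, ζ_M(ρ) = 0 ∧ Re ρ > 1/2`) is the ∀-closure of the tree theorem
`Summit.RiemannHypothesis.RiemannHypothesis.Theorems.Splittings.NbTruncation.exists_zero_gt_half`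
(lane (xv-V), Theorems/Splittings/NbTruncationD.lean: Liouville / χ₅ twists at σ = 1/2, Spira torus
certificates for M = 4, 6, 10, kernel certificates 19, 22–27, 29–1000, and the catalogued barrier
`TuranPartialSums_holds` beyond M = 1000 — whose `native_decide` certificates enter the axiom closure, hence
this file is filed `--computational`). One-line closer, cited by name.
RH-free proof-of-data about SECTIONS of ζ; no summit is proved by this; nothing here bears on the truth of RH.
-/

-- D-0017: `Summit.RiemannHypothesis.RiemannHypothesis.…` duplicates the namespace BY DESIGN (single-problem summit).
set_option linter.dupNamespace false

namespace Summit.RiemannHypothesis.RiemannHypothesis.Theorems.NbTruncationBarrier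

/-- **Crux `SectionZeroRightOfHalf` (item stmt-RiemannHypothesis-21762) holds**: every section `ζ_M`,
`M ≥ 3`, vanishes somewhere in `Re s > 1/2` — the tree theorem
`Splittings.NbTruncation.exists_zero_gt_half`, by name. RH-free (computational closure for `M > 1000`). -/
theorem sectionZeroRightOfHalf_proof :
    Summit.RiemannHypothesis.RiemannHypothesis.Theses.NbTruncationBarrier.SectionZeroRightOfHalf :=
  fun _M hM ↦ Splittings.NbTruncation.exists_zero_gt_half hM

end Summit.RiemannHypothesis.RiemannHypothesis.Theorems.NbTruncationBarrier
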